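import Mathlib
import HarnessLib
import Summits.NavierStokesRegularity.NavierStokesRegularity.Theorems.QuarterLogPincerSmoothSilenceKernel
import Summits.NavierStokesRegularity.NavierStokesRegularity.Theorems.QuarterLogPincerSmoothSilenceNormalisation
import Summits.NavierStokesRegularity.NavierStokesRegularity.Theorems.QuarterLogPincerSmoothSilenceVorticityTransport
import Summits.NavierStokesRegularity.NavierStokesRegularity.Theorems.QuarterLogPincerSilencingCostKernel

/-!
# Route `QuarterLogPincer`, crux `TypeIQuantSubcubicExp` (stmt-NavierStokesRegularity-24077), line `smooth_silence` —
# ASSEMBLY BY NAME: E2 `TerminalEmber` modulo exactly L♯2, Sa♯ and Sb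

The workfile's product `terminalEmber_of_smooth_stubs : TerminalEmber` (`smooth_silence` v1.2) rests on five stubs.  Three of them
are now tree theorems BY NAME — L♯1 `stub_smoothNormalisation` (`…SmoothSilenceNormalisation`, p710038), Sv♯ `stub_vorticityTransport`
(`…SmoothSilenceVorticityTransport`, p710077), Sd `SilencingCost.stub_emberReadout` (`…SilencingCostKernel`, p708348; `EmberReadout` is the
imported `SilencingCost.EmberReadout`) — and the exclusion of smooth vanishing witnesses `no_smoothVanishingWitness` is unconditional
(`…SmoothSilenceKernel`, p709993).  This file records the resulting implications over the ported kernel, each with only the OPEN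
stubs as hypotheses:

* `driftStretchSilencingCost_of_limitStep : SmoothLimitStep → DriftStretchSilencingCost` (Sc″ ⟸ L♯2),
* `sharpEnstrophyPersistence_of_limitStep : SmoothLimitStep → SharpEnstrophyPersistence` (Sc♯ ⟸ L♯2),
* `terminalEmber_of_limitStep_of_aftermath_of_vortical : SmoothLimitStep → SharpAftermath → VorticalCentre → TerminalEmber`
  (E2 ⟸ L♯2 + Sa♯ + Sb).

HONEST FRAME: implications between Props about HYPOTHETICAL objects; L♯2, Sa♯, Sb are OPEN; nothing here bears on E2's truth, the
crux, W7 or Navier–Stokes regularity (OPEN / not proved).  pub-ns-dss typer (g38), `--supports stmt-NavierStokesRegularity-24077`.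
-/

noncomputable section

set_option linter.dupNamespace false

namespace Summit.NavierStokesRegularity.NavierStokesRegularity.Cruxes.TypeIQuantSubcubicExp.SmoothSilence

open Summit.NavierStokesRegularity.NavierStokesRegularity.Cruxes.TypeIQuantSubcubicExp.EmberCensus (TerminalEmber)
open Summit.NavierStokesRegularity.NavierStokesRegularity.Cruxes.TypeIQuantSubcubicExp.SilencingCost
  (VorticalCentre EmberReadout stub_emberReadout)

/-- **Sc″ ⟸ L♯2**: the drift–stretch silencing cost follows from the compactness step alone (normalisation L♯1 and the
exclusion of smooth vanishing witnesses are tree theorems). -/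
theorem driftStretchSilencingCost_of_limitStep (h₂ : SmoothLimitStep) : DriftStretchSilencingCost :=
  driftStretchSilencingCost_of stub_smoothNormalisation h₂

/-- **Sc♯ ⟸ L♯2**: sharp enstrophy persistence from the compactness step (Sv♯ is a tree theorem). -/
theorem sharpEnstrophyPersistence_of_limitStep (h₂ : SmoothLimitStep) : SharpEnstrophyPersistence :=
  sharpEnstrophyPersistence_of stub_vorticityTransport (driftStretchSilencingCost_of_limitStep h₂)

/-- **E2 ⟸ L♯2 + Sa♯ + Sb**: `TerminalEmber` of `ember_census` from the three remaining stubs of `smooth_silence` (Sd, Sv♯, L♯1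
and the witness exclusion are tree theorems). -/
theorem terminalEmber_of_limitStep_of_aftermath_of_vortical (h₂ : SmoothLimitStep) (hA : SharpAftermath)
    (hB : VorticalCentre) : TerminalEmber :=
  terminalEmber_of_sharp hA hB (sharpEnstrophyPersistence_of_limitStep h₂) stub_emberReadout

end Summit.NavierStokesRegularity.NavierStokesRegularity.Cruxes.TypeIQuantSubcubicExp.SmoothSilence

end
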